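import Mathlib
import Summits.NavierStokesRegularity.NavierStokesRegularity.Theorems.SubOnsagerCeilingVirtualFloorFaces
import Summits.NavierStokesRegularity.NavierStokesRegularity.Theorems.SubOnsagerCeilingVirtualFloorGame
import HarnessLib

/-!
# Ω-COUPLED FOUR-SHELL WINDOWS, BOUNDED FORM: the faces also receive `x, v, z ≤ c`
(helper file for crux stmt-NavierStokesRegularity-27057 `SubOnsagerCeiling.ForwardTailCeilingKP`, `--supports … --as helper`;
LEAD SOC census v11 §I.7, line «kp-shell-barrier»)

Variant of `SubOnsagerCeilingVirtualFloorWindow4` (`window4_le_of_coupledCert`, p679187): identical scheme (every window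
`(Yₙ,…,Yₙ₊₃)` of the rescaled chain stays in a polytope-plus-cubic-floor region `Ω`, one simultaneous first-exit argument,
neighbour windows in `Ω` constrain feed `v` and drain `z`) and identical data, but every per-face hypothesis ALSO receives
`x₀, x₁, x₂, x₃, v, z ≤ c` — free in the simultaneous argument (each of these shells is the top coordinate of a window still
in `Ω ⊂ {x₃ ≤ c}`, or a vanishing shell). LEAD g8 numerics (census v11 §I.7): without `v ≤ c` the feed is bounded only through
the cubic floor (`≈ 1.3`), which breaks the floor faces of the measured designs. Proof adapted from the sibling verbatim.
No numerical certificate is proved here. MODEL lattice; nothing here bears on Navier–Stokes regularity; 27057 stays OPEN.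
[cite: BarbatoMorandinRomito2011, §2 Lemma 2.1] [cite: Hartman2002, Ch. III §4 Cor 4.1]
-/

noncomputable section

-- the sub-problem namespace `NavierStokesRegularity.NavierStokesRegularity` is the tree's layout (D-0017)
set_option linter.dupNamespace false

namespace Summit.NavierStokesRegularity.NavierStokesRegularity.Theorems.VirtualFloor

open Set Filter Topology

set_option maxHeartbeats 800000 in
/-- **Ω-coupled four-shell windows, bounded form**: as `window4_le_of_coupledCert`, but the per-face hypotheses `hLin`,
`hFlo` also receive `x₀, x₁, x₂, x₃ ≤ c` and `v, z ≤ c` (feed and drain are shells, hence capped while all windows are in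
`Ω ⊂ {x₃ ≤ c}`). Conclusion: every shell `≤ c`. MODEL-lattice ODE lemma. [cite: BarbatoMorandinRomito2011, §2 Lemma 2.1] -/
theorem window4_le_of_coupledCertB {Y : ℕ → ℝ → ℝ} {κ F : ℕ → ℝ} {L p s δ₀ b2 c : ℝ} {K : ℕ}
    {m : ℕ} {a : Fin m → Fin 4 → ℝ} {cf : Fin m → ℝ} {κf εf : Fin 3 → ℝ}
    (hs : 0 < s) (hκ : ∀ n, 0 ≤ κ n) (hκg : ∀ n, κ (n + 1) = b2 * κ n) (hF : ∀ n, 0 < F n)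
    (hFL : ∀ n, F (n + 1) = L * F n)
    (hInit : ∀ x₀ x₁ x₂ x₃ : ℝ, 0 ≤ x₀ → x₀ ≤ δ₀ → 0 ≤ x₁ → x₁ ≤ δ₀ → 0 ≤ x₂ → x₂ ≤ δ₀ → 0 ≤ x₃ → x₃ ≤ δ₀ →
      (∀ j, a j 0 * x₀ + a j 1 * x₁ + a j 2 * x₂ + a j 3 * x₃ ≤ cf j) ∧
        κf 0 * x₀ ^ 3 - εf 0 ≤ x₁ ∧ κf 1 * x₁ ^ 3 - εf 1 ≤ x₂ ∧ κf 2 * x₂ ^ 3 - εf 2 ≤ x₃)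
    (hSafe : ∀ x₀ x₁ x₂ x₃ : ℝ, 0 ≤ x₀ → 0 ≤ x₁ → 0 ≤ x₂ → 0 ≤ x₃ →
      (∀ j, a j 0 * x₀ + a j 1 * x₁ + a j 2 * x₂ + a j 3 * x₃ ≤ cf j) →
      κf 0 * x₀ ^ 3 - εf 0 ≤ x₁ → κf 1 * x₁ ^ 3 - εf 1 ≤ x₂ → κf 2 * x₂ ^ 3 - εf 2 ≤ x₃ → x₃ ≤ c)
    (hLin : ∀ j, ∀ x₀ x₁ x₂ x₃ v z : ℝ, 0 ≤ x₀ → 0 ≤ x₁ → 0 ≤ x₂ → 0 ≤ x₃ → 0 ≤ v → 0 ≤ z →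
      x₀ ≤ c → x₁ ≤ c → x₂ ≤ c → x₃ ≤ c → v ≤ c → z ≤ c →
      (∀ j', a j' 0 * x₀ + a j' 1 * x₁ + a j' 2 * x₂ + a j' 3 * x₃ ≤ cf j') →
      κf 0 * x₀ ^ 3 - εf 0 ≤ x₁ → κf 1 * x₁ ^ 3 - εf 1 ≤ x₂ → κf 2 * x₂ ^ 3 - εf 2 ≤ x₃ →
      (∀ j', a j' 0 * v + a j' 1 * x₀ + a j' 2 * x₁ + a j' 3 * x₂ ≤ cf j') →
      κf 0 * v ^ 3 - εf 0 ≤ x₀ → κf 1 * x₀ ^ 3 - εf 1 ≤ x₁ → κf 2 * x₁ ^ 3 - εf 2 ≤ x₂ →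
      (∀ j', a j' 0 * x₁ + a j' 1 * x₂ + a j' 2 * x₃ + a j' 3 * z ≤ cf j') →
      κf 0 * x₁ ^ 3 - εf 0 ≤ x₂ → κf 1 * x₂ ^ 3 - εf 1 ≤ x₃ → κf 2 * x₃ ^ 3 - εf 2 ≤ z →
      a j 0 * x₀ + a j 1 * x₁ + a j 2 * x₂ + a j 3 * x₃ = cf j →
      (a j 0 * (v ^ 2 - p * x₀ * x₁) + a j 1 * (L * (x₀ ^ 2 - p * x₁ * x₂)) +
          a j 2 * (L ^ 2 * (x₁ ^ 2 - p * x₂ * x₃)) + a j 3 * (L ^ 3 * (x₂ ^ 2 - p * x₃ * z)) < 0) ∧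
      0 ≤ a j 0 * x₀ + a j 1 * (b2 * x₁) + a j 2 * (b2 ^ 2 * x₂) + a j 3 * (b2 ^ 3 * x₃))
    (hFlo : ∀ i : Fin 3, ∀ x₀ x₁ x₂ x₃ v z : ℝ, 0 ≤ x₀ → 0 ≤ x₁ → 0 ≤ x₂ → 0 ≤ x₃ → 0 ≤ v → 0 ≤ z →
      x₀ ≤ c → x₁ ≤ c → x₂ ≤ c → x₃ ≤ c → v ≤ c → z ≤ c →
      (∀ j', a j' 0 * x₀ + a j' 1 * x₁ + a j' 2 * x₂ + a j' 3 * x₃ ≤ cf j') →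
      κf 0 * x₀ ^ 3 - εf 0 ≤ x₁ → κf 1 * x₁ ^ 3 - εf 1 ≤ x₂ → κf 2 * x₂ ^ 3 - εf 2 ≤ x₃ →
      (∀ j', a j' 0 * v + a j' 1 * x₀ + a j' 2 * x₁ + a j' 3 * x₂ ≤ cf j') →
      κf 0 * v ^ 3 - εf 0 ≤ x₀ → κf 1 * x₀ ^ 3 - εf 1 ≤ x₁ → κf 2 * x₁ ^ 3 - εf 2 ≤ x₂ →
      (∀ j', a j' 0 * x₁ + a j' 1 * x₂ + a j' 2 * x₃ + a j' 3 * z ≤ cf j') →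
      κf 0 * x₁ ^ 3 - εf 0 ≤ x₂ → κf 1 * x₂ ^ 3 - εf 1 ≤ x₃ → κf 2 * x₃ ^ 3 - εf 2 ≤ z →
      (if i = 0 then κf 0 * x₀ ^ 3 - εf 0 = x₁ else if i = 1 then κf 1 * x₁ ^ 3 - εf 1 = x₂
        else κf 2 * x₂ ^ 3 - εf 2 = x₃) →
      (if i = 0 then
          3 * κf 0 * x₀ ^ 2 * (v ^ 2 - p * x₀ * x₁) - L * (x₀ ^ 2 - p * x₁ * x₂) < 0 ∧
            0 ≤ 3 * κf 0 * x₀ ^ 2 * x₀ - b2 * x₁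
        else if i = 1 then
          3 * κf 1 * x₁ ^ 2 * (L * (x₀ ^ 2 - p * x₁ * x₂)) - L ^ 2 * (x₁ ^ 2 - p * x₂ * x₃) < 0 ∧
            0 ≤ 3 * κf 1 * x₁ ^ 2 * (b2 * x₁) - b2 ^ 2 * x₂
        else
          3 * κf 2 * x₂ ^ 2 * (L ^ 2 * (x₁ ^ 2 - p * x₂ * x₃)) - L ^ 3 * (x₂ ^ 2 - p * x₃ * z) < 0 ∧
            0 ≤ 3 * κf 2 * x₂ ^ 2 * (b2 ^ 2 * x₂) - b2 ^ 3 * x₃))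
    (hYz : ∀ n, n ≤ 2 → ∀ t, Y n t = 0)
    (hcont : ∀ n, ContinuousOn (Y n) (Icc 0 s))
    (hderiv : ∀ n, 1 ≤ n → ∀ t ∈ Ico 0 s, HasDerivWithinAt (Y n)
      (-κ n * Y n t + F n * (Y (n - 1) t ^ 2 - p * Y n t * Y (n + 1) t)) (Ici t) t)
    (hpos : ∀ n, ∀ t ∈ Icc 0 s, 0 ≤ Y n t)
    (hinit : ∀ n, Y n 0 ≤ δ₀)
    (htail : ∀ n, K + 1 ≤ n → ∀ t ∈ Icc 0 s, Y n t ≤ δ₀) :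
    ∀ n, ∀ t ∈ Icc 0 s, Y n t ≤ c := by
  have hi0 : ∀ i : Fin 3, i ≠ 0 → i ≠ 1 → i = 2 := by decide
  set InΩ : ℝ → ℝ → ℝ → ℝ → Prop := fun x₀ x₁ x₂ x₃ =>
    0 ≤ x₀ ∧ 0 ≤ x₁ ∧ 0 ≤ x₂ ∧ 0 ≤ x₃ ∧
    (∀ j, a j 0 * x₀ + a j 1 * x₁ + a j 2 * x₂ + a j 3 * x₃ ≤ cf j) ∧
    κf 0 * x₀ ^ 3 - εf 0 ≤ x₁ ∧ κf 1 * x₁ ^ 3 - εf 1 ≤ x₂ ∧ κf 2 * x₂ ^ 3 - εf 2 ≤ x₃ with hInΩ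
  have hbox : ∀ x₀ x₁ x₂ x₃ : ℝ, 0 ≤ x₀ → x₀ ≤ δ₀ → 0 ≤ x₁ → x₁ ≤ δ₀ → 0 ≤ x₂ → x₂ ≤ δ₀ → 0 ≤ x₃ → x₃ ≤ δ₀ →
      InΩ x₀ x₁ x₂ x₃ := by
    intro x₀ x₁ x₂ x₃ h0 h0' h1 h1' h2 h2' h3 h3'
    obtain ⟨hf, hg0, hg1, hg2⟩ := hInit x₀ x₁ x₂ x₃ h0 h0' h1 h1' h2 h2' h3 h3'
    exact ⟨h0, h1, h2, h3, hf, hg0, hg1, hg2⟩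
  have hδ0 : 0 ≤ δ₀ := (hYz 0 (by norm_num) 0).symm.le.trans (hinit 0)
  have hδc : δ₀ ≤ c := by
    obtain ⟨_, _, _, _, hf, hg0, hg1, hg2⟩ := hbox δ₀ δ₀ δ₀ δ₀ hδ0 le_rfl hδ0 le_rfl hδ0 le_rfl hδ0 le_rfl
    exact hSafe δ₀ δ₀ δ₀ δ₀ hδ0 hδ0 hδ0 hδ0 hf hg0 hg1 hg2
  set DY : ℕ → ℝ → ℝ := fun n t =>
    if n = 0 then 0 else -κ n * Y n t + F n * (Y (n - 1) t ^ 2 - p * Y n t * Y (n + 1) t) with hDY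
  have hDer : ∀ n, ∀ t ∈ Ico 0 s, HasDerivWithinAt (Y n) (DY n t) (Ici t) t := by
    intro n t ht
    rcases Nat.eq_zero_or_pos n with rfl | hn
    · have h0 : Y 0 = fun _ => 0 := funext (hYz 0 (by norm_num))
      rw [h0]; simp only [hDY, if_true]; exact hasDerivWithinAt_const t (Ici t) 0
    · have := hderiv n hn t ht
      simp only [hDY, if_neg (Nat.pos_iff_ne_zero.mp hn)]; exact this
  have hrate : ∀ n i, F (n + i) = F n * L ^ i := fun n i => rate_shift hFL n i
  have hdamp : ∀ n i, κ (n + i) = κ n * b2 ^ i := fun n i => rate_shift hκg n i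
  set fd : ℕ → ℝ → ℝ := fun n t => if n = 0 then 0 else Y (n - 1) t with hfd
  have hfd0 : ∀ n t, t ∈ Icc (0:ℝ) s → 0 ≤ fd n t := by
    intro n t ht; simp only [hfd]; split_ifs
    · exact le_rfl
    · exact hpos _ t ht
  have hDYgame : ∀ n (i : ℕ) t, t ∈ Ico (0:ℝ) s → i ≤ 3 →
      DY (n + i) t = -(κ n * b2 ^ i) * Y (n + i) t + F n * L ^ i *
        ((if i = 0 then fd n t else Y (n + i - 1) t) ^ 2 - p * Y (n + i) t * Y (n + i + 1) t) := by
    intro n i t ht hi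
    by_cases hni : n + i = 0
    · have hn0 : n = 0 := by omega
      have hi0' : i = 0 := by omega
      subst hn0; subst hi0'
      simp only [hDY, hfd, Nat.add_zero, if_true]
      rw [hYz 0 (by norm_num) t]; ring
    · simp only [hDY, if_neg hni]
      rw [hrate n i, hdamp n i]
      have e1 : (if i = 0 then fd n t else Y (n + i - 1) t) = Y (n + i - 1) t := by
        split_ifs with hi0'
        · subst hi0'; simp only [hfd, Nat.add_zero]; rw [if_neg (by omega)]
        · rfl
      rw [e1]
  set h : (Fin (K + 1) × (Fin m ⊕ Fin 3)) → ℝ → ℝ := fun nk t =>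
    match nk with
    | (n, Sum.inl j) => a j 0 * Y n t + a j 1 * Y (n + 1) t + a j 2 * Y (n + 2) t + a j 3 * Y (n + 3) t
    | (n, Sum.inr i) =>
      if i = 0 then κf 0 * Y n t ^ 3 - εf 0 - Y (n + 1) t
      else if i = 1 then κf 1 * Y (n + 1) t ^ 3 - εf 1 - Y (n + 2) t
      else κf 2 * Y (n + 2) t ^ 3 - εf 2 - Y (n + 3) t with hh
  set lv : (Fin (K + 1) × (Fin m ⊕ Fin 3)) → ℝ := fun nk => match nk with
    | (_, Sum.inl j) => cf j
    | (_, Sum.inr _) => 0 with hlv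
  set h' : (Fin (K + 1) × (Fin m ⊕ Fin 3)) → ℝ → ℝ := fun nk t =>
    match nk with
    | (n, Sum.inl j) => a j 0 * DY n t + a j 1 * DY (n + 1) t + a j 2 * DY (n + 2) t + a j 3 * DY (n + 3) t
    | (n, Sum.inr i) =>
      if i = 0 then 3 * κf 0 * Y n t ^ 2 * DY n t - DY (n + 1) t
      else if i = 1 then 3 * κf 1 * Y (n + 1) t ^ 2 * DY (n + 1) t - DY (n + 2) t
      else 3 * κf 2 * Y (n + 2) t ^ 2 * DY (n + 2) t - DY (n + 3) t with hh'
  have hcontF : ∀ nk, ContinuousOn (h nk) (Icc 0 s) := by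
    rintro ⟨n, j | i⟩
    · change ContinuousOn (fun t => a j 0 * Y n t + a j 1 * Y (n + 1) t + a j 2 * Y (n + 2) t +
        a j 3 * Y (n + 3) t) (Icc 0 s)
      exact (((continuousOn_const.mul (hcont _)).add (continuousOn_const.mul (hcont _))).add
        (continuousOn_const.mul (hcont _))).add (continuousOn_const.mul (hcont _))
    · by_cases h0 : i = 0
      · subst h0
        change ContinuousOn (fun t => κf 0 * Y n t ^ 3 - εf 0 - Y (n + 1) t) (Icc 0 s)
        exact ((continuousOn_const.mul ((hcont _).pow 3)).sub continuousOn_const).sub (hcont _)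
      by_cases h1 : i = 1
      · subst h1
        change ContinuousOn (fun t => if (1 : Fin 3) = 0 then κf 0 * Y n t ^ 3 - εf 0 - Y (n + 1) t
          else if (1 : Fin 3) = 1 then κf 1 * Y (n + 1) t ^ 3 - εf 1 - Y (n + 2) t
          else κf 2 * Y (n + 2) t ^ 3 - εf 2 - Y (n + 3) t) (Icc 0 s)
        simp only [show ((1 : Fin 3) = 0) = False by decide, if_false, if_true]
        exact ((continuousOn_const.mul ((hcont _).pow 3)).sub continuousOn_const).sub (hcont _)
      obtain rfl := hi0 i h0 h1
      change ContinuousOn (fun t => if (2 : Fin 3) = 0 then κf 0 * Y n t ^ 3 - εf 0 - Y (n + 1) t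
        else if (2 : Fin 3) = 1 then κf 1 * Y (n + 1) t ^ 3 - εf 1 - Y (n + 2) t
        else κf 2 * Y (n + 2) t ^ 3 - εf 2 - Y (n + 3) t) (Icc 0 s)
      simp only [show ((2 : Fin 3) = 0) = False by decide, show ((2 : Fin 3) = 1) = False by decide, if_false]
      exact ((continuousOn_const.mul ((hcont _).pow 3)).sub continuousOn_const).sub (hcont _)
  have hcube : ∀ (f : ℝ → ℝ) (f' t : ℝ), HasDerivWithinAt f f' (Ici t) t →
      HasDerivWithinAt (fun s => f s ^ 3) (3 * f t ^ 2 * f') (Ici t) t := by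
    intro f f' t hf
    have h2 := (hf.mul hf).mul hf
    simp only [Pi.mul_apply] at h2
    have hfun : (fun s => f s ^ 3) = f * f * f := by funext s; simp only [Pi.mul_apply]; ring
    rw [hfun]; exact h2.congr_deriv (by ring)
  have hderF : ∀ nk, ∀ t ∈ Ico 0 s, HasDerivWithinAt (h nk) (h' nk t) (Ici t) t := by
    rintro ⟨n, j | i⟩ t ht
    · change HasDerivWithinAt (fun t => a j 0 * Y n t + a j 1 * Y (n + 1) t + a j 2 * Y (n + 2) t +
        a j 3 * Y (n + 3) t) (a j 0 * DY n t + a j 1 * DY (n + 1) t + a j 2 * DY (n + 2) t + a j 3 * DY (n + 3) t)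
        (Ici t) t
      exact ((((hDer _ t ht).const_mul (a j 0)).add ((hDer _ t ht).const_mul (a j 1))).add
        ((hDer _ t ht).const_mul (a j 2))).add ((hDer _ t ht).const_mul (a j 3))
    · by_cases h0 : i = 0
      · subst h0
        change HasDerivWithinAt (fun t => κf 0 * Y n t ^ 3 - εf 0 - Y (n + 1) t)
          (3 * κf 0 * Y n t ^ 2 * DY n t - DY (n + 1) t) (Ici t) t
        have h3 := ((hcube (Y n) (DY n t) t (hDer _ t ht)).const_mul (κf 0)).sub_const (εf 0)
        exact (h3.sub (hDer _ t ht)).congr_deriv (by ring)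
      by_cases h1 : i = 1
      · subst h1
        change HasDerivWithinAt (fun t => if (1 : Fin 3) = 0 then κf 0 * Y n t ^ 3 - εf 0 - Y (n + 1) t
          else if (1 : Fin 3) = 1 then κf 1 * Y (n + 1) t ^ 3 - εf 1 - Y (n + 2) t
          else κf 2 * Y (n + 2) t ^ 3 - εf 2 - Y (n + 3) t)
          (if (1 : Fin 3) = 0 then 3 * κf 0 * Y n t ^ 2 * DY n t - DY (n + 1) t
          else if (1 : Fin 3) = 1 then 3 * κf 1 * Y (n + 1) t ^ 2 * DY (n + 1) t - DY (n + 2) t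
          else 3 * κf 2 * Y (n + 2) t ^ 2 * DY (n + 2) t - DY (n + 3) t) (Ici t) t
        simp only [show ((1 : Fin 3) = 0) = False by decide, if_false, if_true]
        have h3 := ((hcube (Y (n + 1)) (DY (n + 1) t) t (hDer _ t ht)).const_mul (κf 1)).sub_const (εf 1)
        exact (h3.sub (hDer _ t ht)).congr_deriv (by ring)
      obtain rfl := hi0 i h0 h1
      change HasDerivWithinAt (fun t => if (2 : Fin 3) = 0 then κf 0 * Y n t ^ 3 - εf 0 - Y (n + 1) t
        else if (2 : Fin 3) = 1 then κf 1 * Y (n + 1) t ^ 3 - εf 1 - Y (n + 2) t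
        else κf 2 * Y (n + 2) t ^ 3 - εf 2 - Y (n + 3) t)
        (if (2 : Fin 3) = 0 then 3 * κf 0 * Y n t ^ 2 * DY n t - DY (n + 1) t
        else if (2 : Fin 3) = 1 then 3 * κf 1 * Y (n + 1) t ^ 2 * DY (n + 1) t - DY (n + 2) t
        else 3 * κf 2 * Y (n + 2) t ^ 2 * DY (n + 2) t - DY (n + 3) t) (Ici t) t
      simp only [show ((2 : Fin 3) = 0) = False by decide, show ((2 : Fin 3) = 1) = False by decide, if_false]
      have h3 := ((hcube (Y (n + 2)) (DY (n + 2) t) t (hDer _ t ht)).const_mul (κf 2)).sub_const (εf 2)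
      exact (h3.sub (hDer _ t ht)).congr_deriv (by ring)
  have hwin : ∀ t ∈ Icc 0 s, ∀ n : Fin (K + 1), (∀ k, h (n, k) t ≤ lv (n, k)) →
      InΩ (Y n t) (Y (n + 1) t) (Y (n + 2) t) (Y (n + 3) t) := by
    intro t ht n hall
    refine ⟨hpos _ t ht, hpos _ t ht, hpos _ t ht, hpos _ t ht, fun j => hall (Sum.inl j), ?_, ?_, ?_⟩
    · have := hall (Sum.inr 0)
      change κf 0 * Y n t ^ 3 - εf 0 - Y (n + 1) t ≤ 0 at this; linarith
    · have := hall (Sum.inr 1)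
      change (if (1 : Fin 3) = 0 then κf 0 * Y n t ^ 3 - εf 0 - Y (n + 1) t
        else if (1 : Fin 3) = 1 then κf 1 * Y (n + 1) t ^ 3 - εf 1 - Y (n + 2) t
        else κf 2 * Y (n + 2) t ^ 3 - εf 2 - Y (n + 3) t) ≤ 0 at this
      simp only [show ((1 : Fin 3) = 0) = False by decide, if_false, if_true] at this; linarith
    · have := hall (Sum.inr 2)
      change (if (2 : Fin 3) = 0 then κf 0 * Y n t ^ 3 - εf 0 - Y (n + 1) t
        else if (2 : Fin 3) = 1 then κf 1 * Y (n + 1) t ^ 3 - εf 1 - Y (n + 2) t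
        else κf 2 * Y (n + 2) t ^ 3 - εf 2 - Y (n + 3) t) ≤ 0 at this
      simp only [show ((2 : Fin 3) = 0) = False by decide, show ((2 : Fin 3) = 1) = False by decide,
        if_false] at this; linarith
  have hwinN : ∀ t ∈ Icc 0 s, (∀ nk, h nk t ≤ lv nk) → ∀ n : ℕ,
      InΩ (Y n t) (Y (n + 1) t) (Y (n + 2) t) (Y (n + 3) t) := by
    intro t ht hall n
    by_cases hn : n ≤ K
    · exact hwin t ht ⟨n, Nat.lt_succ_of_le hn⟩ (fun k => hall (⟨n, Nat.lt_succ_of_le hn⟩, k))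
    · -- a tail window: all four shells `≤ δ₀`
      push Not at hn
      exact hbox _ _ _ _ (hpos _ t ht) (htail _ (by omega) t ht) (hpos _ t ht) (htail _ (by omega) t ht)
        (hpos _ t ht) (htail _ (by omega) t ht) (hpos _ t ht) (htail _ (by omega) t ht)
  have hbelow : ∀ t ∈ Icc 0 s, (∀ nk, h nk t ≤ lv nk) → ∀ n : ℕ,
      InΩ (fd n t) (Y n t) (Y (n + 1) t) (Y (n + 2) t) := by
    intro t ht hall n
    rcases Nat.eq_zero_or_pos n with rfl | hn
    · simp only [hfd, if_true]
      rw [hYz 0 (by norm_num) t, hYz 1 (by norm_num) t, hYz 2 (by norm_num) t]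
      exact hbox 0 0 0 0 le_rfl hδ0 le_rfl hδ0 le_rfl hδ0 le_rfl hδ0
    · simp only [hfd, if_neg (Nat.pos_iff_ne_zero.mp hn)]
      have := hwinN t ht hall (n - 1)
      rwa [show n - 1 + 1 = n by omega, show n - 1 + 2 = n + 1 by omega, show n - 1 + 3 = n + 2 by omega] at this
  -- every shell is `≤ c` while all windows are in `Ω` (it is a top coordinate of some window, or vanishes)
  have hYc : ∀ t ∈ Icc 0 s, (∀ nk, h nk t ≤ lv nk) → ∀ j : ℕ, Y j t ≤ c := by
    intro t ht hall j
    rcases lt_or_ge j 3 with hj | hj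
    · rw [hYz j (by omega) t]; exact hδ0.trans hδc
    · obtain ⟨k, rfl⟩ : ∃ k, j = k + 3 := ⟨j - 3, by omega⟩
      obtain ⟨h0', h1', h2', h3', hfac, hf0, hf1, hf2⟩ := hwinN t ht hall k
      exact hSafe _ _ _ _ h0' h1' h2' h3' hfac hf0 hf1 hf2
  have hfdc : ∀ t ∈ Icc 0 s, (∀ nk, h nk t ≤ lv nk) → ∀ n : ℕ, fd n t ≤ c := by
    intro t ht hall n; simp only [hfd]; split_ifs
    · exact hδ0.trans hδc
    · exact hYc t ht hall _
  -- the strict active-face condition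
  have hface : ∀ t ∈ Ico 0 s, (∀ nk, h nk t ≤ lv nk) → ∀ nk, h nk t = lv nk → h' nk t < 0 := by
    intro t ht hall nk hk
    have htI : t ∈ Icc 0 s := Ico_subset_Icc_self ht
    obtain ⟨n, k⟩ := nk
    -- the state and its neighbours
    obtain ⟨hx0, hx1, hx2, hx3, hfac, hf0, hf1, hf2⟩ := hwinN t htI hall n
    obtain ⟨hv0, -, -, -, hfacB, hfB0, hfB1, hfB2⟩ := hbelow t htI hall n
    obtain ⟨-, -, -, hz0, hfacA, hfA0, hfA1, hfA2⟩ := hwinN t htI hall (n + 1)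
    simp only [show (n : ℕ) + 1 + 1 = n + 2 by omega, show (n : ℕ) + 1 + 2 = n + 3 by omega,
      show (n : ℕ) + 1 + 3 = n + 4 by omega] at hfacA hfA0 hfA1 hfA2 hz0
    have hc0 := hYc t htI hall n
    have hc1 := hYc t htI hall (n + 1)
    have hc2 := hYc t htI hall (n + 2)
    have hc3 := hYc t htI hall (n + 3)
    have hcv := hfdc t htI hall n
    have hcz := hYc t htI hall (n + 4)
    -- the game form of the four derivatives
    have hFn : 0 < F n := hF n
    have hκn : 0 ≤ κ n := hκ n
    have e0 := hDYgame n 0 t ht (by norm_num)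
    have e1 := hDYgame n 1 t ht (by norm_num)
    have e2 := hDYgame n 2 t ht (by norm_num)
    have e3 := hDYgame n 3 t ht (by norm_num)
    simp only [Nat.add_zero, pow_zero, mul_one, if_true, show (1:ℕ) ≠ 0 from one_ne_zero,
      show (2:ℕ) ≠ 0 from two_ne_zero, show (3:ℕ) ≠ 0 from by norm_num, if_false, pow_one,
      show (n:ℕ) + 1 - 1 = n by omega, show (n:ℕ) + 2 - 1 = n + 1 by omega, show (n:ℕ) + 3 - 1 = n + 2 by omega,
      show (n:ℕ) + 1 + 1 = n + 2 by omega, show (n:ℕ) + 2 + 1 = n + 3 by omega,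
      show (n:ℕ) + 3 + 1 = n + 4 by omega] at e0 e1 e2 e3
    rcases k with j | i
    · have hkj : a j 0 * Y n t + a j 1 * Y (n + 1) t + a j 2 * Y (n + 2) t + a j 3 * Y (n + 3) t = cf j := hk
      obtain ⟨hQ, hSt⟩ := hLin j (Y n t) (Y (n+1) t) (Y (n+2) t) (Y (n+3) t) (fd n t) (Y (n+4) t)
        hx0 hx1 hx2 hx3 hv0 hz0 hc0 hc1 hc2 hc3 hcv hcz hfac hf0 hf1 hf2 hfacB hfB0 hfB1 hfB2 hfacA hfA0 hfA1 hfA2 hkj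
      change a j 0 * DY n t + a j 1 * DY (n + 1) t + a j 2 * DY (n + 2) t + a j 3 * DY (n + 3) t < 0
      rw [e0, e1, e2, e3]
      have key : a j 0 * (-κ n * Y n t + F n * (fd n t ^ 2 - p * Y n t * Y (n + 1) t)) +
          a j 1 * (-(κ n * b2) * Y (n + 1) t + F n * L * (Y n t ^ 2 - p * Y (n + 1) t * Y (n + 2) t)) +
          a j 2 * (-(κ n * b2 ^ 2) * Y (n + 2) t + F n * L ^ 2 * (Y (n + 1) t ^ 2 - p * Y (n + 2) t * Y (n + 3) t)) +
          a j 3 * (-(κ n * b2 ^ 3) * Y (n + 3) t + F n * L ^ 3 * (Y (n + 2) t ^ 2 - p * Y (n + 3) t * Y (n + 4) t)) =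
          F n * (a j 0 * (fd n t ^ 2 - p * Y n t * Y (n + 1) t) + a j 1 * (L * (Y n t ^ 2 - p * Y (n + 1) t * Y (n + 2) t)) +
            a j 2 * (L ^ 2 * (Y (n + 1) t ^ 2 - p * Y (n + 2) t * Y (n + 3) t)) +
            a j 3 * (L ^ 3 * (Y (n + 2) t ^ 2 - p * Y (n + 3) t * Y (n + 4) t))) -
          κ n * (a j 0 * Y n t + a j 1 * (b2 * Y (n + 1) t) + a j 2 * (b2 ^ 2 * Y (n + 2) t) +
            a j 3 * (b2 ^ 3 * Y (n + 3) t)) := by ring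
      rw [key]
      have hneg := mul_neg_of_pos_of_neg hFn hQ
      have hdmp := mul_nonneg hκn hSt
      linarith
    · have hFl := hFlo i (Y n t) (Y (n+1) t) (Y (n+2) t) (Y (n+3) t) (fd n t) (Y (n+4) t)
        hx0 hx1 hx2 hx3 hv0 hz0 hc0 hc1 hc2 hc3 hcv hcz hfac hf0 hf1 hf2 hfacB hfB0 hfB1 hfB2 hfacA hfA0 hfA1 hfA2
      by_cases h0 : i = 0
      · subst h0
        have hk0 : κf 0 * Y n t ^ 3 - εf 0 - Y (n + 1) t = 0 := hk
        simp only [if_true] at hFl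
        obtain ⟨hQ, hSt⟩ := hFl (by linarith)
        change 3 * κf 0 * Y n t ^ 2 * DY n t - DY (n + 1) t < 0
        rw [e0, e1]
        have key : 3 * κf 0 * Y n t ^ 2 * (-κ n * Y n t + F n * (fd n t ^ 2 - p * Y n t * Y (n + 1) t)) -
            (-(κ n * b2) * Y (n + 1) t + F n * L * (Y n t ^ 2 - p * Y (n + 1) t * Y (n + 2) t)) =
            F n * (3 * κf 0 * Y n t ^ 2 * (fd n t ^ 2 - p * Y n t * Y (n + 1) t) -
              L * (Y n t ^ 2 - p * Y (n + 1) t * Y (n + 2) t)) -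
            κ n * (3 * κf 0 * Y n t ^ 2 * Y n t - b2 * Y (n + 1) t) := by ring
        rw [key]
        have hneg := mul_neg_of_pos_of_neg hFn hQ
        have hdmp := mul_nonneg hκn hSt
        linarith
      by_cases h1 : i = 1
      · subst h1
        have hk1 : (if (1 : Fin 3) = 0 then κf 0 * Y n t ^ 3 - εf 0 - Y (n + 1) t
          else if (1 : Fin 3) = 1 then κf 1 * Y (n + 1) t ^ 3 - εf 1 - Y (n + 2) t
          else κf 2 * Y (n + 2) t ^ 3 - εf 2 - Y (n + 3) t) = 0 := hk
        simp only [show ((1 : Fin 3) = 0) = False by decide, if_false, if_true] at hk1 hFl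
        obtain ⟨hQ, hSt⟩ := hFl (by linarith)
        change (if (1 : Fin 3) = 0 then 3 * κf 0 * Y n t ^ 2 * DY n t - DY (n + 1) t
          else if (1 : Fin 3) = 1 then 3 * κf 1 * Y (n + 1) t ^ 2 * DY (n + 1) t - DY (n + 2) t
          else 3 * κf 2 * Y (n + 2) t ^ 2 * DY (n + 2) t - DY (n + 3) t) < 0
        simp only [show ((1 : Fin 3) = 0) = False by decide, if_false, if_true]
        rw [e1, e2]
        have key : 3 * κf 1 * Y (n + 1) t ^ 2 * (-(κ n * b2) * Y (n + 1) t + F n * L * (Y n t ^ 2 - p * Y (n + 1) t * Y (n + 2) t)) -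
            (-(κ n * b2 ^ 2) * Y (n + 2) t + F n * L ^ 2 * (Y (n + 1) t ^ 2 - p * Y (n + 2) t * Y (n + 3) t)) =
            F n * (3 * κf 1 * Y (n + 1) t ^ 2 * (L * (Y n t ^ 2 - p * Y (n + 1) t * Y (n + 2) t)) -
              L ^ 2 * (Y (n + 1) t ^ 2 - p * Y (n + 2) t * Y (n + 3) t)) -
            κ n * (3 * κf 1 * Y (n + 1) t ^ 2 * (b2 * Y (n + 1) t) - b2 ^ 2 * Y (n + 2) t) := by ring
        rw [key]
        have hneg := mul_neg_of_pos_of_neg hFn hQ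
        have hdmp := mul_nonneg hκn hSt
        linarith
      obtain rfl := hi0 i h0 h1
      have hk2 : (if (2 : Fin 3) = 0 then κf 0 * Y n t ^ 3 - εf 0 - Y (n + 1) t
        else if (2 : Fin 3) = 1 then κf 1 * Y (n + 1) t ^ 3 - εf 1 - Y (n + 2) t
        else κf 2 * Y (n + 2) t ^ 3 - εf 2 - Y (n + 3) t) = 0 := hk
      simp only [show ((2 : Fin 3) = 0) = False by decide, show ((2 : Fin 3) = 1) = False by decide,
        if_false] at hk2 hFl
      obtain ⟨hQ, hSt⟩ := hFl (by linarith)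
      change (if (2 : Fin 3) = 0 then 3 * κf 0 * Y n t ^ 2 * DY n t - DY (n + 1) t
        else if (2 : Fin 3) = 1 then 3 * κf 1 * Y (n + 1) t ^ 2 * DY (n + 1) t - DY (n + 2) t
        else 3 * κf 2 * Y (n + 2) t ^ 2 * DY (n + 2) t - DY (n + 3) t) < 0
      simp only [show ((2 : Fin 3) = 0) = False by decide, show ((2 : Fin 3) = 1) = False by decide, if_false]
      rw [e2, e3]
      have key : 3 * κf 2 * Y (n + 2) t ^ 2 * (-(κ n * b2 ^ 2) * Y (n + 2) t + F n * L ^ 2 * (Y (n + 1) t ^ 2 - p * Y (n + 2) t * Y (n + 3) t)) -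
          (-(κ n * b2 ^ 3) * Y (n + 3) t + F n * L ^ 3 * (Y (n + 2) t ^ 2 - p * Y (n + 3) t * Y (n + 4) t)) =
          F n * (3 * κf 2 * Y (n + 2) t ^ 2 * (L ^ 2 * (Y (n + 1) t ^ 2 - p * Y (n + 2) t * Y (n + 3) t)) -
            L ^ 3 * (Y (n + 2) t ^ 2 - p * Y (n + 3) t * Y (n + 4) t)) -
          κ n * (3 * κf 2 * Y (n + 2) t ^ 2 * (b2 ^ 2 * Y (n + 2) t) - b2 ^ 3 * Y (n + 3) t) := by ring
      rw [key]
      have hneg := mul_neg_of_pos_of_neg hFn hQ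
      have hdmp := mul_nonneg hκn hSt
      linarith
  -- initially every window is in `Ω`
  have h0 : ∀ nk, h nk 0 ≤ lv nk := by
    rintro ⟨n, k⟩
    have h00 : (0:ℝ) ∈ Icc 0 s := ⟨le_rfl, hs.le⟩
    obtain ⟨_, _, _, _, hfac, hf0, hf1, hf2⟩ := hbox (Y n 0) (Y (n+1) 0) (Y (n+2) 0) (Y (n+3) 0)
      (hpos _ 0 h00) (hinit _) (hpos _ 0 h00) (hinit _) (hpos _ 0 h00) (hinit _) (hpos _ 0 h00) (hinit _)
    rcases k with j | i
    · exact hfac j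
    · by_cases hi : i = 0
      · subst hi; change κf 0 * Y n 0 ^ 3 - εf 0 - Y (n + 1) 0 ≤ 0; linarith
      by_cases hi1 : i = 1
      · subst hi1
        change (if (1 : Fin 3) = 0 then κf 0 * Y n 0 ^ 3 - εf 0 - Y (n + 1) 0
          else if (1 : Fin 3) = 1 then κf 1 * Y (n + 1) 0 ^ 3 - εf 1 - Y (n + 2) 0
          else κf 2 * Y (n + 2) 0 ^ 3 - εf 2 - Y (n + 3) 0) ≤ 0
        simp only [show ((1 : Fin 3) = 0) = False by decide, if_false, if_true]; linarith
      obtain rfl := hi0 i hi hi1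
      change (if (2 : Fin 3) = 0 then κf 0 * Y n 0 ^ 3 - εf 0 - Y (n + 1) 0
        else if (2 : Fin 3) = 1 then κf 1 * Y (n + 1) 0 ^ 3 - εf 1 - Y (n + 2) 0
        else κf 2 * Y (n + 2) 0 ^ 3 - εf 2 - Y (n + 3) 0) ≤ 0
      simp only [show ((2 : Fin 3) = 0) = False by decide, show ((2 : Fin 3) = 1) = False by decide, if_false]
      linarith
  -- the first-exit lemma over the finite family
  have hall := forall_le_of_hasDerivWithinAt_Ici_of_active_lt (T := s) hcontF hderF hface h0
  -- conclusion: every shell `≤ c`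
  intro n t ht
  exact hYc t ht (hall t ht) n

end Summit.NavierStokesRegularity.NavierStokesRegularity.Theorems.VirtualFloor

end
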